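import Literature.NumberTheory.EllipticCurves.GunriJhaMajumdar2026.CubeSumTwicePrimesFourSeven
import Literature.NumberTheory.EllipticCurves.CaiShuTian2017.CubeSumTwicePrimesProofs
import Literature.NumberTheory.GaloisRepresentations.CubicCharacterOfTwo
import HarnessLib

/-!
# Gunri–Jha–Majumdar 2026 (arXiv:2607.26774, PREPRINT), Thms. 0.1 / 0.2 — PROOFS ONLY: the printed hypothesis in closed form, non-vacuity, and Miller's `BSD(E_{2q}, ℓ)` for every prime `ℓ ≠ 2`

Companion of `GunriJhaMajumdar2026/CubeSumTwicePrimesFourSeven.lean` (the named facts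
`thm01_bsd_cubeSum_twicePrime_fourSeven`, `thm02_fullBSD_cubeSum_twicePrime_partner`, AS PRINTED,
statement-only; cell `bsd-print-cf2`, literature seat `lit g8`, HOME
`run/shared/lean/pub/bsd-print-cf2/`, DOSSIER §19). No definition, no named fact, nothing asserted
here: only theorems PROVED from the tree.

* `qExponent_of_four` / `qExponent_of_seven` / `partnerExponent_of_four` / `partnerExponent_of_seven`
  — the printed `k` (`q = p^k`) and the partner's cube-free exponent, per class.
* `not_exists_pow_three_eq_two_iff_not_exists_sq` — THE PRINTED HYPOTHESIS IN CLOSED FORM: for a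
  prime `p ≡ 4, 7 (mod 9)`, "`2` is not a cube in `𝔽_p`" iff `p ≠ C² + 27D²` (Gauss; Ireland–Rosen
  Prop. 9.6.2 — the tree's
  `GaloisRepresentations.exists_pow_three_eq_two_iff_exists_eq_sq_add_twenty_seven_mul_sq`). So
  Theorems 0.1 / 0.2 cover exactly the primes `p ≡ 4, 7 (mod 9)` off the form `C² + 27D²`.
* `hypotheses_seven`, `hypotheses_thirteen`, `hypothesis_fails_thirtyOne` — both printed classes
  are inhabited (`p = 7`: `E_{98}`; `p = 13`: `E_{26} = 3³ + (−1)³`), and the hypothesis is a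
  genuine restriction (`31 ≡ 4 (mod 9)`, `31 = 2² + 27·1²`, `4³ = 2` in `𝔽₃₁`); the `ZMod 7` and
  `ZMod 31` facts are the tree's (Ireland–Rosen's printed examples), `ZMod 13` is decided here.
* `hasCM_analyticRank_bsdp_of_thm01` — Thm. 0.1 ⇒ `W.HasCM ∧ r_an(W) = 1 ∧ BSD(W, ℓ)` (Miller
  2011 Def. 1.1) for EVERY prime `ℓ ≠ 2`, for any globally minimal model `W` of `E_{2q}`:
  `#Ш_an = #Ш / u ∈ ℚ` with `ord_ℓ u = 0`, and `ord_ℓ #Ш = ord_ℓ #Ш[ℓ^∞]`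
  (`padicValNat_card_addPrimaryComponent`); CM by
  `CaiShuTian2017.hasCM_of_variableChange_eq_cubeSumTwoModel`. In PARTITION currency (modulo the
  PREPRINT): the CM rank-one pairs `(W, 3)` (`3` ramified in `ℚ(√−3)`: CornerF-ramified @ 3),
  `(W, p)`, `(W, ℓ)` odd good; NOT `(W, 2)` (leaf CornerF @ 2 of this cell — excluded in print).
* `hasCM_analyticRank_bsdp_of_thm02` — Thm. 0.2 ⇒ `W.HasCM ∧ r_an(W) = 0 ∧ BSD(W, ℓ)` for every
  prime `ℓ` (rank zero partner; `forall_bsdp_of_bsdTriple'`).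

## References
* [GunriJhaMajumdar2026] S. Gunri, S. Jha, D. Majumdar, arXiv:2607.26774v1 (29 Jul 2026), Thm. 0.1
  (p2 L21–L35), Thm. 0.2 (p2 L36–L40), Remark 0.3 (p2 L41–L45), (0.1) (p1 L35–L39).
* [IrelandRosen1990] K. Ireland, M. Rosen, GTM 84 (2nd ed. 1990), Ch. 9 §6 Prop. 9.6.2 and the
  examples `p = 7`, `p = 31` (tree `GaloisRepresentations/CubicCharacterOfTwo.lean`).
* [Miller2011LMS] R. L. Miller, LMS J. Comput. Math. 14 (2011), §1 and Def. 1.1.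
* [KezukaLi2020] Y. Kezuka, Y. Li, Doc. Math. 25 (2020), (4.1) p. 2139 (the model).
-/

noncomputable section

open scoped Classical

open WeierstrassCurve Literature.NumberTheory.EllipticCurves
  Literature.NumberTheory.EllipticCurves.KezukaLi2020
  Literature.NumberTheory.EllipticCurves.CaiShuTian2017

namespace Literature.NumberTheory.EllipticCurves.GunriJhaMajumdar2026

/-! ### §1. The printed exponents, per class -/

/-- `qExponent p = 1` for `p ≡ 4 (mod 9)`. [cite: GunriJhaMajumdar2026, (0.1) (arXiv v1 p1 L35–L39)] -/
theorem qExponent_of_four {p : ℕ} (h : p % 9 = 4) : qExponent p = 1 := by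
  simp [qExponent, h]

/-- `qExponent p = 2` for `p ≡ 7 (mod 9)`. [cite: GunriJhaMajumdar2026, (0.1) (arXiv v1 p1 L35–L39)] -/
theorem qExponent_of_seven {p : ℕ} (h : p % 9 = 7) : qExponent p = 2 := by
  simp [qExponent, h]

/-- `partnerExponent p = 2` for `p ≡ 4 (mod 9)`.
[cite: GunriJhaMajumdar2026, Thm. 0.2 (arXiv v1 p2 L39–L40)] -/
theorem partnerExponent_of_four {p : ℕ} (h : p % 9 = 4) : partnerExponent p = 2 := by
  simp [partnerExponent, h]

/-- `partnerExponent p = 1` for `p ≡ 7 (mod 9)`.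
[cite: GunriJhaMajumdar2026, Thm. 0.2 (arXiv v1 p2 L39–L40)] -/
theorem partnerExponent_of_seven {p : ℕ} (h : p % 9 = 7) : partnerExponent p = 1 := by
  simp [partnerExponent, h]

/-! ### §2. The printed hypothesis in closed form; non-vacuity; Miller's `BSD(E, ℓ)` currency -/

/-- **The printed hypothesis in closed form (Gauss; Ireland–Rosen Prop. 9.6.2, PROVED in the tree):**
for a prime `p ≡ 4, 7 (mod 9)` (so `p ≡ 1 (mod 3)`), "`2` is not a cube in `𝔽_p`" holds iff `p` is
NOT of the form `C² + 27D²` — by the tree's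
`Literature.NumberTheory.GaloisRepresentations.exists_pow_three_eq_two_iff_exists_eq_sq_add_twenty_seven_mul_sq`.
So Theorems 0.1 / 0.2 cover exactly the primes `p ≡ 4, 7 (mod 9)` with `p ≠ C² + 27D²`.
[cite: GunriJhaMajumdar2026, Thm. 0.1 (arXiv v1 p2 L21), hypothesis "2 is not a cube in 𝔽_p"] [cite: IrelandRosen1990, Ch. 9 §6 Prop. 9.6.2] -/
theorem not_exists_pow_three_eq_two_iff_not_exists_sq {p : ℕ} (hp : p.Prime)
    (h9 : p % 9 = 4 ∨ p % 9 = 7) :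
    (¬ ∃ x : ZMod p, x ^ 3 = 2) ↔ ¬ ∃ C D : ℤ, (p : ℤ) = C ^ 2 + 27 * D ^ 2 := by
  haveI : Fact p.Prime := ⟨hp⟩
  have hp3 : p % 3 = 1 := by omega
  exact (Literature.NumberTheory.GaloisRepresentations.exists_pow_three_eq_two_iff_exists_eq_sq_add_twenty_seven_mul_sq
    hp3).not

/-- Non-vacuity, class `p ≡ 7 (mod 9)`: `p = 7` is prime, `7 ≡ 7 (mod 9)`, and `2` is not a cube in
`𝔽₇` (the tree's `not_exists_pow_three_eq_two_zmod_seven`, Ireland–Rosen's printed example), so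
`q = 49` and `E_{98} : x³ + y³ = 98` is a member of Theorem 0.1's family.
[cite: GunriJhaMajumdar2026, Thm. 0.1 (arXiv v1 p2 L21), hypothesis "2 is not a cube in 𝔽_p"] [cite: IrelandRosen1990, Ch. 9 §6, example after Prop. 9.6.2] -/
theorem hypotheses_seven : Nat.Prime 7 ∧ (7 % 9 = 4 ∨ 7 % 9 = 7) ∧ ¬ ∃ x : ZMod 7, x ^ 3 = 2 :=
  ⟨by norm_num, Or.inr rfl,
    Literature.NumberTheory.GaloisRepresentations.not_exists_pow_three_eq_two_zmod_seven⟩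

/-- Non-vacuity, class `p ≡ 4 (mod 9)`: `2` is not a cube in `𝔽₁₃` (the cubes are `0, ±1, ±5`).
[cite: GunriJhaMajumdar2026, Thm. 0.1 (arXiv v1 p2 L21), hypothesis "2 is not a cube in 𝔽_p"] -/
theorem not_exists_pow_three_eq_two_zmod_thirteen : ¬ ∃ x : ZMod 13, x ^ 3 = 2 := by decide

/-- Non-vacuity, class `p ≡ 4 (mod 9)`: `p = 13` is prime, `13 ≡ 4 (mod 9)`, `2` is not a cube in
`𝔽₁₃`, so `E_{26} : x³ + y³ = 26` (`= 3³ + (−1)³`) is a member of Theorem 0.1's family.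
[cite: GunriJhaMajumdar2026, Thm. 0.1 (arXiv v1 p2 L21), hypothesis "2 is not a cube in 𝔽_p"] -/
theorem hypotheses_thirteen :
    Nat.Prime 13 ∧ (13 % 9 = 4 ∨ 13 % 9 = 7) ∧ ¬ ∃ x : ZMod 13, x ^ 3 = 2 :=
  ⟨by norm_num, Or.inl rfl, not_exists_pow_three_eq_two_zmod_thirteen⟩

/-- The hypothesis is a genuine restriction: `31 ≡ 4 (mod 9)` but `31 = 2² + 27·1²`, so `2 = 4³` in
`𝔽₃₁` (the tree's `exists_pow_three_eq_two_zmod_thirtyOne`, Ireland–Rosen's printed example) and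
`p = 31` is NOT covered by Theorems 0.1 / 0.2 (cf. Remark 0.3).
[cite: GunriJhaMajumdar2026, Remark 0.3 and Thm. 0.1 (arXiv v1 p2 L21, L41–L45)] [cite: IrelandRosen1990, Ch. 9 §6, example after Prop. 9.6.2] -/
theorem hypothesis_fails_thirtyOne : (31 % 9 = 4 ∨ 31 % 9 = 7) ∧ ∃ x : ZMod 31, x ^ 3 = 2 :=
  ⟨Or.inl rfl, Literature.NumberTheory.GaloisRepresentations.exists_pow_three_eq_two_zmod_thirtyOne⟩

/-- **Thm. 0.1 ⇒ CM, analytic rank one and Miller's `BSD(W, ℓ)` for EVERY prime `ℓ ≠ 2`**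
(PROVED bookkeeping), for any globally minimal model `W` of `E_{2q}` (`x³ + y³ = 2p`, `p ≡ 4`, resp.
`x³ + y³ = 2p²`, `p ≡ 7 (mod 9)`; `2` not a cube mod `p`): CM by the tree's
`hasCM_of_variableChange_eq_cubeSumTwoModel` (`j = 0`); `rk = r_an = 1`; `Ш[ℓ^∞]` finite because
`Ш` is; `#Ш_an = #Ш / u ∈ ℚ` and `ord_ℓ #Ш_an = ord_ℓ #Ш − ord_ℓ u = ord_ℓ #Ш = ord_ℓ #Ш[ℓ^∞]`
(`padicValNat_card_addPrimaryComponent`). In PARTITION currency: the pairs `(W, 3)` (CornerF,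
`3` ramified in `ℚ(√−3)`), `(W, p)` and `(W, ℓ)` for odd good `ℓ` — MODULO THE PREPRINT; the pair
`(W, 2)` (leaf CornerF @ 2) is NOT given.
[cite: GunriJhaMajumdar2026, Thm. 0.1 (arXiv:2607.26774v1 p2 L21–L35)] [cite: Miller2011LMS, Def. 1.1 (arXiv:1010.2431 p. 3)] -/
theorem hasCM_analyticRank_bsdp_of_thm01 (h : thm01_bsd_cubeSum_twicePrime_fourSeven)
    {p : ℕ} (hp : p.Prime) (h9 : p % 9 = 4 ∨ p % 9 = 7) (h2 : ¬ ∃ x : ZMod p, x ^ 3 = 2)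
    (W : WeierstrassCurve ℚ) [W.IsElliptic] [W.IsGloballyMinimal]
    (hW : ∃ C : VariableChange ℚ, C • W = cubeSumTwoModel p (qExponent p))
    {ℓ : ℕ} (hℓ : ℓ.Prime) (hℓ2 : ℓ ≠ 2) :
    W.HasCM ∧ W.analyticRank = 1 ∧ BSDp W ℓ := by
  haveI : Fact ℓ.Prime := ⟨hℓ⟩
  obtain ⟨-, har, hrk, hfin, u, hu0, hval, hcard⟩ := h p hp h9 h2 W hW
  haveI : Finite W.sha := hfin
  haveI hfinℓ : Finite (AddCommGroup.primaryComponent W.sha ℓ) :=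
    Finite.of_injective _ Subtype.val_injective
  have hn0 : (Nat.card W.sha : ℚ) ≠ 0 := by exact_mod_cast (Nat.card_pos (α := W.sha)).ne'
  refine ⟨hasCM_of_variableChange_eq_cubeSumTwoModel hW, har, hrk.trans har.symm, hfinℓ,
    (Nat.card W.sha : ℚ) / u, ?_, ?_⟩
  · have huC : (u : ℂ) ≠ 0 := by exact_mod_cast hu0
    rw [Rat.cast_div, Rat.cast_natCast, eq_div_iff huC]
    exact hcard.symm
  · rw [padicValRat.div hn0 hu0, hval ℓ hℓ hℓ2, sub_zero, padicValRat.of_nat,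
      padicValNat_card_addPrimaryComponent]

/-- **Thm. 0.2 ⇒ Miller's `BSD(W, ℓ)` at EVERY prime `ℓ` (including `2`) for the rank-zero
partner** (PROVED bookkeeping: `BSDTriple ⇒ ∀ ℓ, BSD(W, ℓ)` is the tree's
`forall_bsdp_of_bsdTriple'`), together with CM and `r_an = 0`. Off the rank-one leaf (rank zero is
Burungale–Flach's row in the partition); recorded so that the partner's status is by name too.
MODULO THE PREPRINT (for `L(1) ≠ 0`).
[cite: GunriJhaMajumdar2026, Thm. 0.2 (arXiv:2607.26774v1 p2 L39–L40)] [cite: Miller2011LMS, Def. 1.1 (arXiv:1010.2431 p. 3)] -/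
theorem hasCM_analyticRank_bsdp_of_thm02 (h : thm02_fullBSD_cubeSum_twicePrime_partner)
    {p : ℕ} (hp : p.Prime) (h9 : p % 9 = 4 ∨ p % 9 = 7) (h2 : ¬ ∃ x : ZMod p, x ^ 3 = 2)
    (W : WeierstrassCurve ℚ) [W.IsElliptic] [W.IsGloballyMinimal]
    (hW : ∃ C : VariableChange ℚ, C • W = cubeSumTwoModel p (partnerExponent p))
    {ℓ : ℕ} (hℓ : ℓ.Prime) :
    W.HasCM ∧ W.analyticRank = 0 ∧ BSDp W ℓ := by
  obtain ⟨hrk, hT⟩ := h p hp h9 h2 W hW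
  have har : W.analyticRank = 0 := by
    have h1 : W.analyticRank = W.mordellWeilRank := ((bsdTriple_iff W).1 hT).1
    rw [h1, hrk]
  exact ⟨hasCM_of_variableChange_eq_cubeSumTwoModel hW, har, forall_bsdp_of_bsdTriple' W hT ℓ hℓ⟩

end Literature.NumberTheory.EllipticCurves.GunriJhaMajumdar2026
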